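import Summits.CriticalPhenomena.PercolationContinuityZ3.Theorems.Transplant.SkelFrm1ParamsPO
import Summits.CriticalPhenomena.PercolationContinuityZ3.Theorems.Transplant.SkelNeg1ParamsO
import Summits.CriticalPhenomena.PercolationContinuityZ3.Theorems.Transplant.SkelNegParamsLatticeInv
import Summits.CriticalPhenomena.PercolationContinuityZ3.Theorems.Transplant.SkelNegParamsFineMult
import Summits.CriticalPhenomena.PercolationContinuityZ3.Theorems.Transplant.SkelNeg1ParamsL
import Summits.CriticalPhenomena.PercolationContinuityZ3.Theorems.Transplant.PlanarSkeletonFrmDefs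
import Summits.CriticalPhenomena.PercolationContinuityZ3.Theorems.Transplant.SkelPhiStepIDataNS
import Summits.CriticalPhenomena.PercolationContinuityZ3.Theorems.Transplant.SkelNegBParamsL
import HarnessLib

/-!
# N2 (frames-only node `SamePDropOfSkeletonFrm₁`, OPEN) params column over `PlanarSkeletonFrm` — (ζ″) ledger, shape (B′) of record ((R-14)):
# MECHANICAL PORT of N1's `SkelNeg1ParamsL` — part 3b (O-level, skeleton-level): THE LONG SCALE with the clearance as an explicit SLOT `f` — `Neg.nL κ Φ t p D f`, the long
# equilibrium data `hL/ℓL/vL`, the second lattice vector `vβL`, the window map of record `Neg.coarse` (ρ∘φ at the long data), the fine multipliers `m₀/m₁` and the two-unit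
# … (N1 title abridged; see `SkelNeg1ParamsL`)
builds on p205010 (kernel theorem, internal audit signed; external expert review pending) — nothing in this file uses p205010; NOTHING is claimed about the
open node `SamePDropOfSkeletonFrm₁` (`SamePDropOfSkeletonNeg₁` is CLOSED in the tree and untouched by this file).
Status sentence (coordinator 2026-08-20T04:30Z): "θ(p_c) = 0 on ℤ^d, all d ≥ 2 — kernel-verified (Lean 4/Mathlib, standard axioms); internal adversarial
audit SIGNED 2026-08-20 04:29Z; external expert review pending."
Lane `prim-bschramm-*`, seat `prim-bschramm-stmt` (gen 19); helper file (`--supports stmt-CriticalPhenomena-4575 --as helper`); ledger HOME/prim-bschramm-stmt/FRM-PARAMS.md §9, (R-14).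
PORT RULES (HOME/prim-bschramm-stmt-g19/lean/port_frm.py, the tool of record per (R-14)): outer namespace `PlanarSkeletonNeg ↦ PlanarSkeletonFrm`, carrier binder
`(Φ : PlanarSkeletonFrm G)`, record binder `(D : Skelφ.StepI.DataNS V)` (the selectors travel IN the record, `SkelPhiStepIDataNS`); section variables INLINED into every
declaration header; inner namespaces (`Neg`/`NegB`/`KS`/…) and every short name KEPT so all cross-references resolve unchanged; declarations using no section variable are
NOT re-declared (N1's originals are referenced fully qualified). Mathematical content, proofs, docstrings and citations are N1's, verbatim, except where stated next.
SELECTORS IN THIS FILE ((R-14) condition of record — joint selection, `D.sN`'s first argument is the literal handed to `D.sM`): none in part L; part BL (below) draws the LONG pair.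
N1 HEADER (kept for the reader):
helper file (`--supports stmt-CriticalPhenomena-4575 --as helper`); ledger HOME/prim-bschramm-stmt/NEG-PARAMS.md v0.7.
DESIGN OF THIS FILE: the one number of the long width not yet posted by the (R)/(run) records — the clearance floor `f` of NEG-PARAMS (n5)(v)(vi)
(`d₀ + q + 3R′ + 1`, `C_run·R′`) — is an explicit LAST ARGUMENT `f : ℕ` of `Neg.nL` and of everything downstream; every fact below holds for EVERY `f`, so the residues
may cite these names now and the ledger closes the slot later by ONE definition `Neg.fR` (then `Neg.nL κ Φ t p D (Neg.fR …)`).  ORDER: `ML` (part 3a) → **`nL f := NegPrm.nL (max (D.n₁ ML) f) ML K R′`**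
(`= max {D.n₁ ML, f, ML+1, K(R′+2)}`) → long data **`(hL, ℓL, vL) := (D.hgt, D.len, D.spl) t ML (nL f)`** → `vβL := vβOf nL hL ℓL vL` → window map **`coarse := NegPrm.coarse Φ.φ t K nL hL ℓL vL`**
→ multipliers `m₀/m₁ := NegPrm.mOf₀/₁ K nL hL ℓL vL` → cells **`cellsF := ⟨K, ![max 1 m₀.toNat, max 1 m₁.toNat]⟩`** → lists `Sz := {Mu}`, **`SMn f := NegPrm.SMn Mu nS ML (nL f)`**, `m₀ := 1`.
* §1 values; §2 facts: `n₁L_le_nL`, `f_le_nL`, `ML_lt_nL`, `coarse_floor_le_nL`, `nS_lt_nL`, **`eqGeomL_facts`** (the long pair's `EqGeom` in ℤ shapes), **`lip_coarse_at`**, **`coarse_drift_at`**,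
  **`exists_coarse_eq_at`**, **`φ_extent_at`** (LatticeInv at the long data), **`one_le_m_at`/`cellsF_s_at`** (`(cellsF.s i : ℤ) = m_i` under `EqGeom`), `K₀_le_cellsF_K`, **`Sz_adm`**, **`SMn_adm_at`**,
  `mem_SMn_short/long`.
[cite: KozmaNitzan2024, §4 Theorem 6 (pp. 25–31): the order of constants] [cite: MartineauTassion2017, §3.2 Lemma 3.5, §4.1–4.3 (the cell lattice)]
-/

noncomputable section

open scoped Classical

namespace Summit.CriticalPhenomena.PercolationContinuityZ3.Theorems.Transplant

namespace PlanarSkeletonFrm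

namespace Neg

open Literature.Probability.Percolation Literature.Probability.LatticeModels SimpleGraph
open SkelConc (Consts)

section LLevel

/-! ## §1 The values -/

/-- **The long width with clearance slot `f`**: `n_L := max {D.n₁ M_L, f, M_L + 1, K(R′+2)}` (`NegPrm.nL` with the (R)/(run) floors fed through the first slot). [this work] -/
def nL (κ : Consts) {V : Type} [DecidableEq V] [Countable V] {G : SimpleGraph V} [G.LocallyFinite] (Φ : PlanarSkeletonFrm G) (t : V) (p : unitInterval) (D : Skelφ.StepI.DataNS V) (f : ℕ) : ℕ := Skelφ.NegPrm.nL (max (D.n₁ (ML κ Φ t p D)) f) (ML κ Φ t p D) (Neg.K κ) (R' κ Φ t p D)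

/-- The long shear `h_L := D.hgt t M_L n_L`. [this work] -/
def hL (κ : Consts) {V : Type} [DecidableEq V] [Countable V] {G : SimpleGraph V} [G.LocallyFinite] (Φ : PlanarSkeletonFrm G) (t : V) (p : unitInterval) (D : Skelφ.StepI.DataNS V) (f : ℕ) : ℤ := D.hgt t (ML κ Φ t p D) (nL κ Φ t p D f)

/-- The long half-length `ℓ_L := D.len t M_L n_L` (an OUTPUT of Step I″, never a choice). [this work] -/
def ℓL (κ : Consts) {V : Type} [DecidableEq V] [Countable V] {G : SimpleGraph V} [G.LocallyFinite] (Φ : PlanarSkeletonFrm G) (t : V) (p : unitInterval) (D : Skelφ.StepI.DataNS V) (f : ℕ) : ℕ := D.len t (ML κ Φ t p D) (nL κ Φ t p D f)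

/-- The long split point `v_L := D.spl t M_L n_L` (= `v_α` of the second lattice vector). [this work] -/
def vL (κ : Consts) {V : Type} [DecidableEq V] [Countable V] {G : SimpleGraph V} [G.LocallyFinite] (Φ : PlanarSkeletonFrm G) (t : V) (p : unitInterval) (D : Skelφ.StepI.DataNS V) (f : ℕ) : ℤ := D.spl t (ML κ Φ t p D) (nL κ Φ t p D f)

/-- The second lattice vector's height `v_β := vβOf n_L h_L ℓ_L v_L`. [this work] -/
def vβL (κ : Consts) {V : Type} [DecidableEq V] [Countable V] {G : SimpleGraph V} [G.LocallyFinite] (Φ : PlanarSkeletonFrm G) (t : V) (p : unitInterval) (D : Skelφ.StepI.DataNS V) (f : ℕ) : ℤ := Skelφ.NegPrm.vβOf (nL κ Φ t p D f) (hL κ Φ t p D f) (ℓL κ Φ t p D f) (vL κ Φ t p D f)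

/-- **THE WINDOW MAP OF RECORD at the long data**: `ρ ∘ φ := NegPrm.coarse Φ.φ t K n_L h_L ℓ_L v_L`. [this work] -/
def coarse (κ : Consts) {V : Type} [DecidableEq V] [Countable V] {G : SimpleGraph V} [G.LocallyFinite] (Φ : PlanarSkeletonFrm G) (t : V) (p : unitInterval) (D : Skelφ.StepI.DataNS V) (f : ℕ) : V → Site 2 := Skelφ.NegPrm.coarse Φ.φ t (Neg.K κ) (nL κ Φ t p D f) (hL κ Φ t p D f) (ℓL κ Φ t p D f) (vL κ Φ t p D f)

/-- The fine multiplier of axis `0`: `m₀ := mOf₀ K n_L h_L ℓ_L v_L` (`ℤ`). [this work] -/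
def m0 (κ : Consts) {V : Type} [DecidableEq V] [Countable V] {G : SimpleGraph V} [G.LocallyFinite] (Φ : PlanarSkeletonFrm G) (t : V) (p : unitInterval) (D : Skelφ.StepI.DataNS V) (f : ℕ) : ℤ := Skelφ.NegPrm.mOf₀ (Neg.K κ) (nL κ Φ t p D f) (hL κ Φ t p D f) (ℓL κ Φ t p D f) (vL κ Φ t p D f)

/-- The fine multiplier of axis `1`: `m₁ := mOf₁ K n_L h_L ℓ_L v_L` (`ℤ`). [this work] -/
def m1 (κ : Consts) {V : Type} [DecidableEq V] [Countable V] {G : SimpleGraph V} [G.LocallyFinite] (Φ : PlanarSkeletonFrm G) (t : V) (p : unitInterval) (D : Skelφ.StepI.DataNS V) (f : ℕ) : ℤ := Skelφ.NegPrm.mOf₁ (Neg.K κ) (nL κ Φ t p D f) (hL κ Φ t p D f) (ℓL κ Φ t p D f) (vL κ Φ t p D f)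

/-- The fine multipliers as stub increments `s : Fin 2 → ℕ` (`max 1 m_i.toNat`; `= m_i` under the long pair's `EqGeom`). [this work] -/
def mNat (κ : Consts) {V : Type} [DecidableEq V] [Countable V] {G : SimpleGraph V} [G.LocallyFinite] (Φ : PlanarSkeletonFrm G) (t : V) (p : unitInterval) (D : Skelφ.StepI.DataNS V) (f : ℕ) : Fin 2 → ℕ := ![max 1 (m0 κ Φ t p D f).toNat, max 1 (m1 κ Φ t p D f).toNat]

/-- **THE TWO-UNIT CELLS OF N1** `⟨K, m⟩` ((R3): `r_i = K·m_i` fine units = `K` ρ-units). [cite: KozmaNitzan2024, §4 pp. 25–26] -/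
def cellsF (κ : Consts) {V : Type} [DecidableEq V] [Countable V] {G : SimpleGraph V} [G.LocallyFinite] (Φ : PlanarSkeletonFrm G) (t : V) (p : unitInterval) (D : Skelφ.StepI.DataNS V) (f : ℕ) : PCells2 := ⟨Neg.K κ, mNat κ Φ t p D f, (Neg.forty_le_K κ).2.1, fun i => by unfold mNat; fin_cases i <;> exact le_max_left _ _⟩

/-- The zone-scale list `Sz := {M_u}`. [this work] -/
def Sz {V : Type} (D : Skelφ.StepI.DataNS V) : Finset ℕ := Skelφ.Prm.SzOf (Mu D)

/-- **The scale list** `SMn := {(M_u, n_s), (M_L, n_L)}`. [this work] -/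
def SMn (κ : Consts) {V : Type} [DecidableEq V] [Countable V] {G : SimpleGraph V} [G.LocallyFinite] (Φ : PlanarSkeletonFrm G) (t : V) (p : unitInterval) (D : Skelφ.StepI.DataNS V) (f : ℕ) : Finset (ℕ × ℕ) := Skelφ.NegPrm.SMn (Mu D) (nS D) (ML κ Φ t p D) (nL κ Φ t p D f)

export PlanarSkeletonNeg.Neg (m₀)

/-! ## §2 The facts by name -/

/-- `D.n₁ M_L ≤ n_L` (the long pair is admissible) and `f ≤ n_L` (the clearance slot). [folklore] -/
theorem n₁L_le_nL (κ : Consts) {V : Type} [DecidableEq V] [Countable V] {G : SimpleGraph V} [G.LocallyFinite] (Φ : PlanarSkeletonFrm G) (t : V) (p : unitInterval) (D : Skelφ.StepI.DataNS V) (f : ℕ) : D.n₁ (ML κ Φ t p D) ≤ nL κ Φ t p D f ∧ f ≤ nL κ Φ t p D f :=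
  Skelφ.NegPrm.rootClear_le_nL _ f _ _ _

/-- `M_L < n_L` and `K(R′+2) ≤ n_L`. [folklore] -/
theorem ML_lt_nL (κ : Consts) {V : Type} [DecidableEq V] [Countable V] {G : SimpleGraph V} [G.LocallyFinite] (Φ : PlanarSkeletonFrm G) (t : V) (p : unitInterval) (D : Skelφ.StepI.DataNS V) (f : ℕ) : ML κ Φ t p D < nL κ Φ t p D f ∧ Neg.K κ * (R' κ Φ t p D + 2) ≤ nL κ Φ t p D f :=
  ⟨Skelφ.NegPrm.ML_lt_nL _ _ _ _, Skelφ.NegPrm.coarse_floor_le_nL _ _ _ _⟩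

/-- The long scale dominates the short one: `n_s < n_L`. [folklore] -/
theorem nS_lt_nL (κ : Consts) {V : Type} [DecidableEq V] [Countable V] {G : SimpleGraph V} [G.LocallyFinite] (Φ : PlanarSkeletonFrm G) (t : V) (p : unitInterval) (D : Skelφ.StepI.DataNS V) (f : ℕ) : nS D < nL κ Φ t p D f := lt_of_le_of_lt (nS_le_ML κ Φ t p D) (ML_lt_nL κ Φ t p D f).1

/-- The two pairs are listed. [folklore] -/
theorem mem_SMn (κ : Consts) {V : Type} [DecidableEq V] [Countable V] {G : SimpleGraph V} [G.LocallyFinite] (Φ : PlanarSkeletonFrm G) (t : V) (p : unitInterval) (D : Skelφ.StepI.DataNS V) (f : ℕ) : (Mu D, nS D) ∈ SMn κ Φ t p D f ∧ (ML κ Φ t p D, nL κ Φ t p D f) ∈ SMn κ Φ t p D f :=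
  ⟨Skelφ.NegPrm.short_mem_SMn _ _ _ _, Skelφ.NegPrm.long_mem_SMn _ _ _ _⟩

/-- **Zone admissibility** (first conjunct of the closure's OBLIGATION): `∀ M ∈ Sz, D.M₀ ≤ M`. [folklore] -/
theorem Sz_adm {V : Type} (D : Skelφ.StepI.DataNS V) : ∀ M ∈ Sz D, D.M₀ ≤ M := Skelφ.Prm.SzOf_adm (M₀_le_Mu D)

/-- `M_u ∈ Sz`. [folklore] -/
theorem Mu_mem_Sz {V : Type} (D : Skelφ.StepI.DataNS V) : Mu D ∈ Sz D := Skelφ.Prm.Mu_mem_SzOf _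

/-- **Pair admissibility** (second conjunct of the OBLIGATION): `∀ q ∈ SMn, D.M₀ ≤ q.1 ∧ D.n₁ q.1 ≤ q.2` — for EVERY clearance `f`. [folklore] -/
theorem SMn_adm_at (κ : Consts) {V : Type} [DecidableEq V] [Countable V] {G : SimpleGraph V} [G.LocallyFinite] (Φ : PlanarSkeletonFrm G) (t : V) (p : unitInterval) (D : Skelφ.StepI.DataNS V) (f : ℕ) : ∀ q ∈ SMn κ Φ t p D f, D.M₀ ≤ q.1 ∧ D.n₁ q.1 ≤ q.2 :=
  Skelφ.NegPrm.SMn_adm (M₀_le_Mu D) (n₁_le_nS D) ((M₀_le_Mu D).trans (Mu_le_ML κ Φ t p D)) (n₁L_le_nL κ Φ t p D f).1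

export PlanarSkeletonNeg.Neg (m₀_eq)

/-- The ℤ-shape bookkeeping of an `EqGeom` clause (used at both pairs). [folklore] -/
theorem eqGeom_facts_of {V : Type} {G : SimpleGraph V} [G.LocallyFinite] (Φ : PlanarSkeletonFrm G) (t : V) (D : Skelφ.StepI.DataNS V) {M n : ℕ} (hE : D.EqGeom G Φ.φ t M n) :
    M < n ∧ M < D.len t M n ∧ |D.spl t M n| ≤ (n : ℤ) ∧ ((M : ℤ) + 1) * ((n : ℤ) + |D.hgt t M n|) ≤ (n : ℤ) * ((D.len t M n : ℤ) + 1) := by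
  obtain ⟨h1, h2, h3, h4, -⟩ := hE
  refine ⟨h1, h2, h3, ?_⟩
  have e1 : ((n + (D.hgt t M n).natAbs : ℕ) : ℤ) = (n : ℤ) + |D.hgt t M n| := by push_cast; rfl
  have e2 : ((D.len t M n + 1 : ℕ) : ℤ) = (D.len t M n : ℤ) + 1 := by push_cast; rfl
  rw [e1, e2] at h4
  exact h4

/-- **The long pair's geometric clause unpacked** (from `D.EqGeom G Φ.φ t M_L n_L`): `M_L < n_L`, `M_L < ℓ_L`, `|v_L| ≤ n_L`, `(M_L+1)(n_L+|h_L|) ≤ n_L(ℓ_L+1)`, in the ℤ shapes with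
`M := (M_L : ℤ)` that `SkelNegParamsCoarse/Lattice/LatticeInv/FineMult` consume (`M + 1 ≤ n`, `M + 1 ≤ ℓ`). [folklore] -/
theorem eqGeomL_facts (κ : Consts) {V : Type} [DecidableEq V] [Countable V] {G : SimpleGraph V} [G.LocallyFinite] (Φ : PlanarSkeletonFrm G) (t : V) (p : unitInterval) (D : Skelφ.StepI.DataNS V) (f : ℕ) (hE : D.EqGeom G Φ.φ t (ML κ Φ t p D) (nL κ Φ t p D f)) :
    ((ML κ Φ t p D : ℤ) + 1 ≤ (nL κ Φ t p D f : ℕ)) ∧ ((ML κ Φ t p D : ℤ) + 1 ≤ (ℓL κ Φ t p D f : ℕ)) ∧ |vL κ Φ t p D f| ≤ (nL κ Φ t p D f : ℤ) ∧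
      ((ML κ Φ t p D : ℤ) + 1) * ((nL κ Φ t p D f : ℤ) + |hL κ Φ t p D f|) ≤ (nL κ Φ t p D f : ℤ) * ((ℓL κ Φ t p D f : ℤ) + 1) := by
  obtain ⟨h1, h2, h3, h4⟩ := eqGeom_facts_of Φ t D hE
  refine ⟨?_, ?_, h3, h4⟩
  · have : ML κ Φ t p D + 1 ≤ nL κ Φ t p D f := h1
    exact_mod_cast this
  · have : ML κ Φ t p D + 1 ≤ ℓL κ Φ t p D f := h2
    exact_mod_cast this

/-- **THE WINDOW MAP IS 1-LIPSCHITZ** at the ledger's values (floor `4K + 2 ≤ M_L` from `kit_floors_ML`). [this work] -/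
theorem lip_coarse_at (κ : Consts) {V : Type} [DecidableEq V] [Countable V] {G : SimpleGraph V} [G.LocallyFinite] (Φ : PlanarSkeletonFrm G) (t : V) (p : unitInterval) (D : Skelφ.StepI.DataNS V) (f : ℕ) (hE : D.EqGeom G Φ.φ t (ML κ Φ t p D) (nL κ Φ t p D f)) : Skelφ.Lip G (coarse κ Φ t p D f) := by
  obtain ⟨hn, hℓ, hv, hlay⟩ := eqGeomL_facts κ Φ t p D f hE
  have hM := (kit_floors_ML κ Φ t p D).2.1
  exact Skelφ.NegPrm.lip_coarse Φ.lip t (by exact_mod_cast hM) hn hℓ hlay hv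

/-- **KIT DRIFT READS AS ONE ρ-UNIT** at the ledger's values: planar displacement `≤ R′` per coordinate ⇒ coarse displacement `≤ 1` per coordinate (`c_R′ = 1`; floor `4K·R′ + 2 ≤ M_L`).
[this work] -/
theorem coarse_drift_at (κ : Consts) {V : Type} [DecidableEq V] [Countable V] {G : SimpleGraph V} [G.LocallyFinite] (Φ : PlanarSkeletonFrm G) (t : V) (p : unitInterval) (D : Skelφ.StepI.DataNS V) (f : ℕ) (hE : D.EqGeom G Φ.φ t (ML κ Φ t p D) (nL κ Φ t p D f)) {w w' : V} (h0 : |Φ.φ w 0 - Φ.φ w' 0| ≤ (R' κ Φ t p D : ℤ))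
    (h1 : |Φ.φ w 1 - Φ.φ w' 1| ≤ (R' κ Φ t p D : ℤ)) (i : Fin 2) : |coarse κ Φ t p D f w i - coarse κ Φ t p D f w' i| ≤ 1 := by
  obtain ⟨hn, hℓ, hv, hlay⟩ := eqGeomL_facts κ Φ t p D f hE
  have hM := (kit_floors_ML κ Φ t p D).1
  exact Skelφ.NegPrm.coarse_drift_le_one t (by positivity) (by exact_mod_cast hM) hn hℓ hlay hv h0 h1 i

/-- **EVERY COARSE CELL IS HIT** at the ledger's values (floor `8K + 2 ≤ M_L`; unit steps of `Φ.φ`). [this work] -/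
theorem exists_coarse_eq_at (κ : Consts) {V : Type} [DecidableEq V] [Countable V] {G : SimpleGraph V} [G.LocallyFinite] (Φ : PlanarSkeletonFrm G) (t : V) (p : unitInterval) (D : Skelφ.StepI.DataNS V) (f : ℕ) (hE : D.EqGeom G Φ.φ t (ML κ Φ t p D) (nL κ Φ t p D f)) (w₀ : V) (z : Site 2) :
    ∃ g, coarse κ Φ t p D f g = z := by
  obtain ⟨hn, hℓ, hv, hlay⟩ := eqGeomL_facts κ Φ t p D f hE
  have hM := (kit_floors_ML κ Φ t p D).2.2
  obtain ⟨g, -, hg⟩ := Skelφ.NegPrm.exists_coarse_eq Φ.step t w₀ (Neg.forty_le_K κ).2.2 (by exact_mod_cast hM) hn hℓ hlay hv z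
  exact ⟨g, hg⟩

/-- **A ρ-BOX IS A φ-BOX** at the ledger's values: `|Δρ|_∞ ≤ r ⇒ K·|Δφ_i| ≤ 80·(n_L + ℓ_L + 3|h_L| + 1)·(r+1)` (the schedule's `rmaxφ` conversion). [this work] -/
theorem φ_extent_at (κ : Consts) {V : Type} [DecidableEq V] [Countable V] {G : SimpleGraph V} [G.LocallyFinite] (Φ : PlanarSkeletonFrm G) (t : V) (p : unitInterval) (D : Skelφ.StepI.DataNS V) (f : ℕ) (hE : D.EqGeom G Φ.φ t (ML κ Φ t p D) (nL κ Φ t p D f)) {w w' : V} {r : ℤ} (hr : 0 ≤ r)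
    (hρ : ∀ i, |coarse κ Φ t p D f w i - coarse κ Φ t p D f w' i| ≤ r) (i : Fin 2) :
    (Neg.K κ : ℤ) * |Φ.φ w i - Φ.φ w' i| ≤ 80 * ((nL κ Φ t p D f : ℤ) + ℓL κ Φ t p D f + 3 * |hL κ Φ t p D f| + 1) * (r + 1) := by
  obtain ⟨hn, hℓ, hv, -⟩ := eqGeomL_facts κ Φ t p D f hE
  have hn1 : 1 ≤ nL κ Φ t p D f := by
    have : (1 : ℤ) ≤ nL κ Φ t p D f := by linarith
    exact_mod_cast this
  have hℓ1 : 1 ≤ ℓL κ Φ t p D f := by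
    have : (1 : ℤ) ≤ ℓL κ Φ t p D f := by linarith
    exact_mod_cast this
  exact Skelφ.NegPrm.φ_extent_of_coarse_extent t hn1 hℓ1 _ hv hr hρ i

/-- **The multipliers are at least `R′ + 1`** (hence `≥ 2`, quasi-step exit frames; `10·m_i ≥ Rlev + 4`, face rows) at the ledger's values (`4K·R′+2 ≤ M_L` ⇒ `4K(R′+1)+2 ≤ …`? no:
we use `s := R′` for axis 0's floor `4K·s + 2 ≤ M_L` verbatim and `K·s + 2 ≤ M_L` for axis 1). [this work] -/
theorem R'_le_m_at (κ : Consts) {V : Type} [DecidableEq V] [Countable V] {G : SimpleGraph V} [G.LocallyFinite] (Φ : PlanarSkeletonFrm G) (t : V) (p : unitInterval) (D : Skelφ.StepI.DataNS V) (f : ℕ) (hE : D.EqGeom G Φ.φ t (ML κ Φ t p D) (nL κ Φ t p D f)) :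
    (R' κ Φ t p D : ℤ) ≤ m0 κ Φ t p D f ∧ (R' κ Φ t p D : ℤ) ≤ m1 κ Φ t p D f := by
  obtain ⟨hn, hℓ, hv, hlay⟩ := eqGeomL_facts κ Φ t p D f hE
  have hM := (kit_floors_ML κ Φ t p D).1
  have hM' : 4 * (Neg.K κ : ℤ) * (R' κ Φ t p D : ℤ) + 2 ≤ (ML κ Φ t p D : ℤ) := by exact_mod_cast hM
  exact Skelφ.NegPrm.le_mOf_both (Neg.forty_le_K κ).2.2 (by positivity) hM' hn hℓ hlay hv

/-- `1 ≤ m₀` and `1 ≤ m₁` at the ledger's values. [folklore] -/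
theorem one_le_m_at (κ : Consts) {V : Type} [DecidableEq V] [Countable V] {G : SimpleGraph V} [G.LocallyFinite] (Φ : PlanarSkeletonFrm G) (t : V) (p : unitInterval) (D : Skelφ.StepI.DataNS V) (f : ℕ) (hE : D.EqGeom G Φ.φ t (ML κ Φ t p D) (nL κ Φ t p D f)) : 1 ≤ m0 κ Φ t p D f ∧ 1 ≤ m1 κ Φ t p D f := by
  have h := R'_le_m_at κ Φ t p D f hE
  have hR : (1 : ℤ) ≤ R' κ Φ t p D := by exact_mod_cast (one_le_R' κ Φ t p D).1
  exact ⟨hR.trans h.1, hR.trans h.2⟩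

/-- **The cells' stub increments ARE the multipliers** under the long pair's `EqGeom`: `((cellsF).s i : ℤ) = m_i`. [folklore] -/
theorem cellsF_s_at (κ : Consts) {V : Type} [DecidableEq V] [Countable V] {G : SimpleGraph V} [G.LocallyFinite] (Φ : PlanarSkeletonFrm G) (t : V) (p : unitInterval) (D : Skelφ.StepI.DataNS V) (f : ℕ) (hE : D.EqGeom G Φ.φ t (ML κ Φ t p D) (nL κ Φ t p D f)) :
    (((cellsF κ Φ t p D f).s 0 : ℕ) : ℤ) = m0 κ Φ t p D f ∧ (((cellsF κ Φ t p D f).s 1 : ℕ) : ℤ) = m1 κ Φ t p D f := by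
  obtain ⟨h0, h1⟩ := one_le_m_at κ Φ t p D f hE
  have e0 : (cellsF κ Φ t p D f).s 0 = max 1 (m0 κ Φ t p D f).toNat := rfl
  have e1 : (cellsF κ Φ t p D f).s 1 = max 1 (m1 κ Φ t p D f).toNat := rfl
  rw [e0, e1]
  constructor
  · rw [max_eq_right (by omega), Int.toNat_of_nonneg (by omega)]
  · rw [max_eq_right (by omega), Int.toNat_of_nonneg (by omega)]

/-- The cells' `K` is `Neg.K κ` (so `κ.K₀ ≤ K`: the `WFHolds`-type clause) and `r_i = K·s_i`. [folklore] -/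
theorem cellsF_K (κ : Consts) {V : Type} [DecidableEq V] [Countable V] {G : SimpleGraph V} [G.LocallyFinite] (Φ : PlanarSkeletonFrm G) (t : V) (p : unitInterval) (D : Skelφ.StepI.DataNS V) (f : ℕ) : (cellsF κ Φ t p D f).K = Neg.K κ ∧ κ.K₀ ≤ (cellsF κ Φ t p D f).K ∧ ∀ i, (cellsF κ Φ t p D f).r i = Neg.K κ * (cellsF κ Φ t p D f).s i :=
  ⟨rfl, Neg.K₀_le_K κ, fun _ => rfl⟩

/-- **The per-axis resolutions satisfy `c_i·L_i ≤ D`** at the ledger's values (for hp-8's `lip_fineSkel`-type hypotheses): with `c_i := 20K·(cellsF).s i`. [this work] -/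
theorem cL_le_D_at (κ : Consts) {V : Type} [DecidableEq V] [Countable V] {G : SimpleGraph V} [G.LocallyFinite] (Φ : PlanarSkeletonFrm G) (t : V) (p : unitInterval) (D : Skelφ.StepI.DataNS V) (f : ℕ) (hE : D.EqGeom G Φ.φ t (ML κ Φ t p D) (nL κ Φ t p D f)) :
    20 * (Neg.K κ : ℤ) * (((cellsF κ Φ t p D f).s 0 : ℕ) : ℤ) * (|(800 : ℤ)| * (|vβL κ Φ t p D f| + |vL κ Φ t p D f|)) ≤
        Skelφ.NegPrm.Dof (nL κ Φ t p D f) (hL κ Φ t p D f) (ℓL κ Φ t p D f) (vL κ Φ t p D f) ∧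
      20 * (Neg.K κ : ℤ) * (((cellsF κ Φ t p D f).s 1 : ℕ) : ℤ) * (|(800 : ℤ)| * (|(nL κ Φ t p D f : ℤ)| + |hL κ Φ t p D f|)) ≤
        Skelφ.NegPrm.Dof (nL κ Φ t p D f) (hL κ Φ t p D f) (ℓL κ Φ t p D f) (vL κ Φ t p D f) := by
  obtain ⟨hn, hℓ, -, -⟩ := eqGeomL_facts κ Φ t p D f hE
  have hn1 : 1 ≤ nL κ Φ t p D f := by
    have : (1 : ℤ) ≤ nL κ Φ t p D f := by linarith
    exact_mod_cast this
  have hℓ1 : 1 ≤ ℓL κ Φ t p D f := by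
    have : (1 : ℤ) ≤ ℓL κ Φ t p D f := by linarith
    exact_mod_cast this
  obtain ⟨e0, e1⟩ := cellsF_s_at κ Φ t p D f hE
  rw [e0, e1]
  exact ⟨Skelφ.NegPrm.cL_le_D₀ hn1 hℓ1 _ _, Skelφ.NegPrm.cL_le_D₁ hn1 hℓ1 _ _⟩

end LLevel

end Neg

end PlanarSkeletonFrm

end Summit.CriticalPhenomena.PercolationContinuityZ3.Theorems.Transplant

end

/-!
# N2 (frames-only node `SamePDropOfSkeletonFrm₁`, OPEN) params column over `PlanarSkeletonFrm` — (ζ″) ledger, shape (B′) of record ((R-14)):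
# MECHANICAL PORT of N1's `SkelNegBParamsL` — chain of record `NegB` (the `Neg` chain RE-VERSIONED ONCE with a BOX slot), part L: the long box **`NegB.ML κ Φ t p D g := max
# (Neg.ML …) g`**, the long width `NegB.nL κ Φ t p D g f`, the long data `hL/ℓL/vL/vβL`, the multipliers `m0/m1`, the pair list `SMn g f` — every landed floor of `Neg.ML` …
# (N1 title abridged; see `SkelNegBParamsL`)
builds on p205010 (kernel theorem, internal audit signed; external expert review pending) — nothing in this file uses p205010; NOTHING is claimed about the
open node `SamePDropOfSkeletonFrm₁` (`SamePDropOfSkeletonNeg₁` is CLOSED in the tree and untouched by this file).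
Status sentence (coordinator 2026-08-20T04:30Z): "θ(p_c) = 0 on ℤ^d, all d ≥ 2 — kernel-verified (Lean 4/Mathlib, standard axioms); internal adversarial
audit SIGNED 2026-08-20 04:29Z; external expert review pending."
Lane `prim-bschramm-*`, seat `prim-bschramm-stmt` (gen 19); helper file (`--supports stmt-CriticalPhenomena-4575 --as helper`); ledger HOME/prim-bschramm-stmt/FRM-PARAMS.md §9, (R-14).
PORT RULES (HOME/prim-bschramm-stmt-g19/lean/port_frm.py, the tool of record per (R-14)): outer namespace `PlanarSkeletonNeg ↦ PlanarSkeletonFrm`, carrier binder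
`(Φ : PlanarSkeletonFrm G)`, record binder `(D : Skelφ.StepI.DataNS V)` (the selectors travel IN the record, `SkelPhiStepIDataNS`); section variables INLINED into every
declaration header; inner namespaces (`Neg`/`NegB`/`KS`/…) and every short name KEPT so all cross-references resolve unchanged; declarations using no section variable are
NOT re-declared (N1's originals are referenced fully qualified). Mathematical content, proofs, docstrings and citations are N1's, verbatim, except where stated next.
SELECTORS IN THIS FILE ((R-14) condition of record — joint selection, `D.sN`'s first argument is the literal handed to `D.sM`): LONG pair `ML g := D.sM (max (Neg.ML …) g)`, `nL g f := D.sN (max (Neg.ML …) g) (NegPrm.nL (max (n₁ M_L) f) M_L K R′)` (zone floor `max (Neg.ML …) g` in BOTH selectors; slots `g f` keep their N1 meaning); `long_pair_eq` by rfl; `ML_le_ML/n₁L_le_nL/ML_lt_nL` gain one `le_sM/le_sN` step.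
N1 HEADER (kept for the reader):
helper file (`--supports stmt-CriticalPhenomena-4575 --as helper`); ledger HOME/prim-bschramm-stmt/NEG-PARAMS.md v0.10.
WHY THE RE-VERSION (located, stmt-g13 2026-08-21T15:45:24Z): the (R) ruling N1-R-PLAN v2 / B.13 (p3-g9 15:38:39Z) adds a third Step-I″ pair `(M_b, n_b)` (the BRIDGE) chosen AFTER the kit
block, and the long box must dominate the bridge parallelogram: `M_L + 1 ≥ 2C′(n_b + ℓ_b + |h_b|) + 1` — a BOX floor with data the landed `Neg.ML` (short data only, no slot) cannot see.
So the chain of record is re-typed in the namespace `NegB` with TWO slots: `g` (extra BOX floors: the bridge's, the kit layer's) and `f` (extra WIDTH floors: (R-F1)_b, `C_run·R′`);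
every value and fact holds for EVERY `(g, f)`, and the ledger closes both slots at the end (`NegB.gR`, `NegB.fR`).  The `Neg` one-slot chain (p277618 …) stays as the `g = 0` reading.
Names: the SAME short names as `Neg` (`ML nL hL ℓL vL vβL m0 m1 SMn …`), one more argument `g`; the zone scale / short pair / kit block (`Mu ρz nS hS ℓS vS As Mk T₀ … Rlev R'`,
`Sz`, `m₀`) are `Neg`'s unchanged (no box dependence).
* §1 `ML`, `ML_le_ML` (`Neg.ML ≤ ML g`, `g ≤ ML g`), `Mu_le_ML`, `nS_le_ML`, `hop_floor_le_ML`, `slack_floor_le_ML`, `coarse_floor_le_ML`, `kit_floors_ML` (the landed floors, transferred);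
* §2 `nL g f`, `hL/ℓL/vL/vβL/m0/m1`, `SMn g f`; §3 `n₁L_le_nL`, `ML_lt_nL`, `nS_lt_nL`, `mem_SMn`, `SMn_adm_at`.
[cite: KozmaNitzan2024, §4 Theorem 6 (pp. 25–31): the order of constants] [cite: MartineauTassion2017, §3.2 Lemma 3.5, §4.1–4.3]
-/

noncomputable section

open scoped Classical

namespace Summit.CriticalPhenomena.PercolationContinuityZ3.Theorems.Transplant

namespace PlanarSkeletonFrm

namespace NegB

open Literature.Probability.Percolation Literature.Probability.LatticeModels SimpleGraph
open SkelConc (Consts)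
open Neg

section LLevel

/-! ## §1 The long box with the box slot -/

/-- **THE LONG BOX OF RECORD with floor slot `g`**: `M_L := max (Neg.ML κ Φ t p D) g` (`Neg.ML` = the v0 floors `{M_u, 16(|h_s|+ℓ_s+n_s), 959, 4K(R′+2)}`; `g` = the box floors
posted later: the bridge's `16(n_b + ℓ_b + |h_b|)`, the kit layer's). [this work] -/
def ML (κ : Consts) {V : Type} [DecidableEq V] [Countable V] {G : SimpleGraph V} [G.LocallyFinite] (Φ : PlanarSkeletonFrm G) (t : V) (p : unitInterval) (D : Skelφ.StepI.DataNS V) (g : ℕ) : ℕ := D.sM (max (Neg.ML κ Φ t p D) g)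

/-- `Neg.ML ≤ M_L` and `g ≤ M_L`. [folklore] -/
theorem ML_le_ML (κ : Consts) {V : Type} [DecidableEq V] [Countable V] {G : SimpleGraph V} [G.LocallyFinite] (Φ : PlanarSkeletonFrm G) (t : V) (p : unitInterval) (D : Skelφ.StepI.DataNS V) (g : ℕ) : Neg.ML κ Φ t p D ≤ ML κ Φ t p D g ∧ g ≤ ML κ Φ t p D g :=
  ⟨(le_max_left _ _).trans (D.le_sM _), (le_max_right _ _).trans (D.le_sM _)⟩

/-- `M_u ≤ M_L`. [folklore] -/
theorem Mu_le_ML (κ : Consts) {V : Type} [DecidableEq V] [Countable V] {G : SimpleGraph V} [G.LocallyFinite] (Φ : PlanarSkeletonFrm G) (t : V) (p : unitInterval) (D : Skelφ.StepI.DataNS V) (g : ℕ) : Mu D ≤ ML κ Φ t p D g := (Neg.Mu_le_ML κ Φ t p D).trans (ML_le_ML κ Φ t p D g).1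

/-- `n_s ≤ M_L`. [folklore] -/
theorem nS_le_ML (κ : Consts) {V : Type} [DecidableEq V] [Countable V] {G : SimpleGraph V} [G.LocallyFinite] (Φ : PlanarSkeletonFrm G) (t : V) (p : unitInterval) (D : Skelφ.StepI.DataNS V) (g : ℕ) : nS D ≤ ML κ Φ t p D g := (Neg.nS_le_ML κ Φ t p D).trans (ML_le_ML κ Φ t p D g).1

/-- D4's hop floor `2C′(|h_s|+ℓ_s+n_s) ≤ M_L`. [folklore] -/
theorem hop_floor_le_ML (κ : Consts) {V : Type} [DecidableEq V] [Countable V] {G : SimpleGraph V} [G.LocallyFinite] (Φ : PlanarSkeletonFrm G) (t : V) (p : unitInterval) (D : Skelφ.StepI.DataNS V) (g : ℕ) : 2 * Neg.C' * ((hS t D).natAbs + ℓS t D + nS D) ≤ ML κ Φ t p D g :=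
  (Neg.hop_floor_le_ML κ Φ t p D).trans (ML_le_ML κ Φ t p D g).1

/-- The slack floor `960 ≤ M_L + 1`. [folklore] -/
theorem slack_floor_le_ML (κ : Consts) {V : Type} [DecidableEq V] [Countable V] {G : SimpleGraph V} [G.LocallyFinite] (Φ : PlanarSkeletonFrm G) (t : V) (p : unitInterval) (D : Skelφ.StepI.DataNS V) (g : ℕ) : 960 ≤ ML κ Φ t p D g + 1 := by
  have h1 := Neg.slack_floor_le_ML κ Φ t p D
  have h2 := (ML_le_ML κ Φ t p D g).1
  omega

/-- The coarse/kit floors `4K(R′+2) ≤ M_L`, `4K ≤ M_L`. [folklore] -/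
theorem coarse_floor_le_ML (κ : Consts) {V : Type} [DecidableEq V] [Countable V] {G : SimpleGraph V} [G.LocallyFinite] (Φ : PlanarSkeletonFrm G) (t : V) (p : unitInterval) (D : Skelφ.StepI.DataNS V) (g : ℕ) : 4 * Neg.K κ * (R' κ Φ t p D + 2) ≤ ML κ Φ t p D g ∧ 4 * Neg.K κ ≤ ML κ Φ t p D g :=
  ⟨(Neg.coarse_floor_le_ML κ Φ t p D).1.trans (ML_le_ML κ Φ t p D g).1, (Neg.coarse_floor_le_ML κ Φ t p D).2.trans (ML_le_ML κ Φ t p D g).1⟩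

/-- `4K·R′ + 2 ≤ M_L`, `4K + 2 ≤ M_L`, `8K + 2 ≤ M_L`. [folklore] -/
theorem kit_floors_ML (κ : Consts) {V : Type} [DecidableEq V] [Countable V] {G : SimpleGraph V} [G.LocallyFinite] (Φ : PlanarSkeletonFrm G) (t : V) (p : unitInterval) (D : Skelφ.StepI.DataNS V) (g : ℕ) : 4 * Neg.K κ * R' κ Φ t p D + 2 ≤ ML κ Φ t p D g ∧ 4 * Neg.K κ + 2 ≤ ML κ Φ t p D g ∧ 8 * Neg.K κ + 2 ≤ ML κ Φ t p D g := by
  obtain ⟨h1, h2, h3⟩ := Neg.kit_floors_ML κ Φ t p D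
  have h := (ML_le_ML κ Φ t p D g).1
  exact ⟨h1.trans h, h2.trans h, h3.trans h⟩

/-! ## §2 The long width, data, multipliers, list -/

/-- **The long width with box slot `g` and clearance slot `f`**: `n_L := max {D.n₁ M_L, f, M_L + 1, K(R′+2)}`. [this work] -/
def nL (κ : Consts) {V : Type} [DecidableEq V] [Countable V] {G : SimpleGraph V} [G.LocallyFinite] (Φ : PlanarSkeletonFrm G) (t : V) (p : unitInterval) (D : Skelφ.StepI.DataNS V) (g : ℕ) (f : ℕ) : ℕ := D.sN (max (Neg.ML κ Φ t p D) g) (Skelφ.NegPrm.nL (max (D.n₁ (ML κ Φ t p D g)) f) (ML κ Φ t p D g) (Neg.K κ) (R' κ Φ t p D))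

/-- The long shear `h_L := D.hgt t M_L n_L`. [this work] -/
def hL (κ : Consts) {V : Type} [DecidableEq V] [Countable V] {G : SimpleGraph V} [G.LocallyFinite] (Φ : PlanarSkeletonFrm G) (t : V) (p : unitInterval) (D : Skelφ.StepI.DataNS V) (g : ℕ) (f : ℕ) : ℤ := D.hgt t (ML κ Φ t p D g) (nL κ Φ t p D g f)

/-- The long half-length `ℓ_L := D.len t M_L n_L`. [this work] -/
def ℓL (κ : Consts) {V : Type} [DecidableEq V] [Countable V] {G : SimpleGraph V} [G.LocallyFinite] (Φ : PlanarSkeletonFrm G) (t : V) (p : unitInterval) (D : Skelφ.StepI.DataNS V) (g : ℕ) (f : ℕ) : ℕ := D.len t (ML κ Φ t p D g) (nL κ Φ t p D g f)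

/-- The long split point `v_L := D.spl t M_L n_L`. [this work] -/
def vL (κ : Consts) {V : Type} [DecidableEq V] [Countable V] {G : SimpleGraph V} [G.LocallyFinite] (Φ : PlanarSkeletonFrm G) (t : V) (p : unitInterval) (D : Skelφ.StepI.DataNS V) (g : ℕ) (f : ℕ) : ℤ := D.spl t (ML κ Φ t p D g) (nL κ Φ t p D g f)

/-- The second lattice vector's height `v_β := vβOf n_L h_L ℓ_L v_L`. [this work] -/
def vβL (κ : Consts) {V : Type} [DecidableEq V] [Countable V] {G : SimpleGraph V} [G.LocallyFinite] (Φ : PlanarSkeletonFrm G) (t : V) (p : unitInterval) (D : Skelφ.StepI.DataNS V) (g : ℕ) (f : ℕ) : ℤ := Skelφ.NegPrm.vβOf (nL κ Φ t p D g f) (hL κ Φ t p D g f) (ℓL κ Φ t p D g f) (vL κ Φ t p D g f)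

/-- The maximal fine multiplier of axis `0`: `m₀ := mOf₀ K n_L h_L ℓ_L v_L`. [this work] -/
def m0 (κ : Consts) {V : Type} [DecidableEq V] [Countable V] {G : SimpleGraph V} [G.LocallyFinite] (Φ : PlanarSkeletonFrm G) (t : V) (p : unitInterval) (D : Skelφ.StepI.DataNS V) (g : ℕ) (f : ℕ) : ℤ := Skelφ.NegPrm.mOf₀ (Neg.K κ) (nL κ Φ t p D g f) (hL κ Φ t p D g f) (ℓL κ Φ t p D g f) (vL κ Φ t p D g f)

/-- The maximal fine multiplier of axis `1`: `m₁ := mOf₁ K n_L h_L ℓ_L v_L`. [this work] -/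
def m1 (κ : Consts) {V : Type} [DecidableEq V] [Countable V] {G : SimpleGraph V} [G.LocallyFinite] (Φ : PlanarSkeletonFrm G) (t : V) (p : unitInterval) (D : Skelφ.StepI.DataNS V) (g : ℕ) (f : ℕ) : ℤ := Skelφ.NegPrm.mOf₁ (Neg.K κ) (nL κ Φ t p D g f) (hL κ Φ t p D g f) (ℓL κ Φ t p D g f) (vL κ Φ t p D g f)

/-- **The two ledger pairs** `SMn := {(M_u, n_s), (M_L, n_L)}`. [this work] -/
def SMn (κ : Consts) {V : Type} [DecidableEq V] [Countable V] {G : SimpleGraph V} [G.LocallyFinite] (Φ : PlanarSkeletonFrm G) (t : V) (p : unitInterval) (D : Skelφ.StepI.DataNS V) (g : ℕ) (f : ℕ) : Finset (ℕ × ℕ) := Skelφ.NegPrm.SMn (Mu D) (nS D) (ML κ Φ t p D g) (nL κ Φ t p D g f)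

/-- **The long pair IS the selected pair** at zone floor `max (Neg.ML …) g` and width floor `NegPrm.nL (max (n₁ M_L) f) M_L K R′` (by `rfl`). [folklore] -/
theorem long_pair_eq (κ : Consts) {V : Type} [DecidableEq V] [Countable V] {G : SimpleGraph V} [G.LocallyFinite] (Φ : PlanarSkeletonFrm G) (t : V) (p : unitInterval) (D : Skelφ.StepI.DataNS V) (g : ℕ) (f : ℕ) :
    ML κ Φ t p D g = D.sM (max (Neg.ML κ Φ t p D) g) ∧
      nL κ Φ t p D g f = D.sN (max (Neg.ML κ Φ t p D) g) (Skelφ.NegPrm.nL (max (D.n₁ (ML κ Φ t p D g)) f) (ML κ Φ t p D g) (Neg.K κ) (R' κ Φ t p D)) :=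
  ⟨rfl, rfl⟩

/-! ## §3 The facts by name -/

/-- `D.n₁ M_L ≤ n_L` and `f ≤ n_L`. [folklore] -/
theorem n₁L_le_nL (κ : Consts) {V : Type} [DecidableEq V] [Countable V] {G : SimpleGraph V} [G.LocallyFinite] (Φ : PlanarSkeletonFrm G) (t : V) (p : unitInterval) (D : Skelφ.StepI.DataNS V) (g : ℕ) (f : ℕ) : D.n₁ (ML κ Φ t p D g) ≤ nL κ Φ t p D g f ∧ f ≤ nL κ Φ t p D g f :=
  ⟨(Skelφ.NegPrm.rootClear_le_nL _ f _ _ _).1.trans (D.le_sN _ _), (Skelφ.NegPrm.rootClear_le_nL _ f _ _ _).2.trans (D.le_sN _ _)⟩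

/-- `M_L < n_L` and `K(R′+2) ≤ n_L`. [folklore] -/
theorem ML_lt_nL (κ : Consts) {V : Type} [DecidableEq V] [Countable V] {G : SimpleGraph V} [G.LocallyFinite] (Φ : PlanarSkeletonFrm G) (t : V) (p : unitInterval) (D : Skelφ.StepI.DataNS V) (g : ℕ) (f : ℕ) : ML κ Φ t p D g < nL κ Φ t p D g f ∧ Neg.K κ * (R' κ Φ t p D + 2) ≤ nL κ Φ t p D g f :=
  ⟨(Skelφ.NegPrm.ML_lt_nL _ _ _ _).trans_le (D.le_sN _ _), (Skelφ.NegPrm.coarse_floor_le_nL _ _ _ _).trans (D.le_sN _ _)⟩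

/-- `n_s < n_L`. [folklore] -/
theorem nS_lt_nL (κ : Consts) {V : Type} [DecidableEq V] [Countable V] {G : SimpleGraph V} [G.LocallyFinite] (Φ : PlanarSkeletonFrm G) (t : V) (p : unitInterval) (D : Skelφ.StepI.DataNS V) (g : ℕ) (f : ℕ) : nS D < nL κ Φ t p D g f := lt_of_le_of_lt (nS_le_ML κ Φ t p D g) (ML_lt_nL κ Φ t p D g f).1

/-- The two pairs are listed. [folklore] -/
theorem mem_SMn (κ : Consts) {V : Type} [DecidableEq V] [Countable V] {G : SimpleGraph V} [G.LocallyFinite] (Φ : PlanarSkeletonFrm G) (t : V) (p : unitInterval) (D : Skelφ.StepI.DataNS V) (g : ℕ) (f : ℕ) : (Mu D, nS D) ∈ SMn κ Φ t p D g f ∧ (ML κ Φ t p D g, nL κ Φ t p D g f) ∈ SMn κ Φ t p D g f :=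
  ⟨Skelφ.NegPrm.short_mem_SMn _ _ _ _, Skelφ.NegPrm.long_mem_SMn _ _ _ _⟩

/-- **Pair admissibility**: `∀ q ∈ SMn, D.M₀ ≤ q.1 ∧ D.n₁ q.1 ≤ q.2` — for every `(g, f)`. [folklore] -/
theorem SMn_adm_at (κ : Consts) {V : Type} [DecidableEq V] [Countable V] {G : SimpleGraph V} [G.LocallyFinite] (Φ : PlanarSkeletonFrm G) (t : V) (p : unitInterval) (D : Skelφ.StepI.DataNS V) (g : ℕ) (f : ℕ) : ∀ q ∈ SMn κ Φ t p D g f, D.M₀ ≤ q.1 ∧ D.n₁ q.1 ≤ q.2 :=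
  Skelφ.NegPrm.SMn_adm (M₀_le_Mu D) (n₁_le_nS D) ((M₀_le_Mu D).trans (Mu_le_ML κ Φ t p D g)) (n₁L_le_nL κ Φ t p D g f).1

end LLevel

end NegB

end PlanarSkeletonFrm

end Summit.CriticalPhenomena.PercolationContinuityZ3.Theorems.Transplant

end
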